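import Mathlib.Tactic.DeriveFintype
import Literature.Computability.Complexity.SplitOnesBricks
import HarnessLib

/-!
# A brick for one-hot and zero-led words: the leading block of `0`s, recoded in unary

Trunk toolkit, one more finite-state transduction next to `SplitOnesBricks.lean`
(`onesPrefixFn`: the leading block of `1`s): **`zerosPrefixFn w = 1ʲ` for `w = 0ʲ 1 z`** — the
unary numeral of the position of the first `1` of `w` (`1^{|w|}` if `w` has no `1`). It lets a
machine written in the algebra of `FP` string functions (`BrickAlgebra.lean`) read the INDEX off a
one-hot word `eⱼ = 0ʲ 1 0^{K-j-1}`, the format in which the indexed parallel copies of a quantum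
circuit family (`QuantumComplexity/PolyCopiesIdx.lean`: block `j` receives `x ++ eⱼ`) tell each copy
its number; first consumer: the query generator of the average-case-to-worst-case bridge for
search-`LWE` (`Cryptography/LWEAmplifyQuery.lean`).

* `zerosPrefixFn`, `zerosPrefixFn_replicate_append` (`0ʲ 1 z ↦ 1ʲ`), `zerosPrefixFn_mem_FP`,
  `length_zerosPrefixFn_le`.

## References

* S. Arora, B. Barak, *Computational Complexity: A Modern Approach*, CUP 2009, §1.3 (unary
  counters; finite-state string processing is polynomial time).
-/

namespace Literature.Computability.Complexity

open _root_.Computability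

/-! ### The function -/

/-- The number of leading `0`s of a word. [folklore] -/
def leadingZeros : List Bool → ℕ
  | false :: w => leadingZeros w + 1
  | _ => 0

/-- `leadingZeros (0ʲ 1 z) = j`. [folklore] -/
@[simp] theorem leadingZeros_replicate_append (j : ℕ) (z : List Bool) :
    leadingZeros (List.replicate j false ++ true :: z) = j := by
  induction j with
  | zero => rfl
  | succ j ih => simp [List.replicate_succ, leadingZeros, ih]

/-- `leadingZeros w ≤ |w|`. [folklore] -/
theorem leadingZeros_le : ∀ w : List Bool, leadingZeros w ≤ w.length
  | [] => le_rfl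
  | false :: w => by simp only [leadingZeros, List.length_cons]; exact Nat.succ_le_succ (leadingZeros_le w)
  | true :: w => Nat.zero_le _

/-- **`zerosPrefixFn w = 1^{leadingZeros w}`**: the position of the first `1`, in unary. [folklore] -/
def zerosPrefixFn (w : List Bool) : List Bool := ones (leadingZeros w)

/-- **On a one-hot / zero-led word: `zerosPrefixFn (0ʲ 1 z) = 1ʲ`.** [folklore] -/
@[simp] theorem zerosPrefixFn_replicate_append (j : ℕ) (z : List Bool) :
    zerosPrefixFn (List.replicate j false ++ true :: z) = ones j := by
  simp [zerosPrefixFn]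

/-- `|zerosPrefixFn w| ≤ |w|`. [folklore] -/
theorem length_zerosPrefixFn_le (w : List Bool) : (zerosPrefixFn w).length ≤ w.length := by
  simp only [zerosPrefixFn, ones, List.length_replicate]
  exact leadingZeros_le w

/-! ### The transducer -/

/-- States of the transducer: inside the leading block of `0`s, or past it. [folklore] -/
inductive ZPS
  | run
  | done
  deriving DecidableEq, Fintype

/-- Transition: emit `1` for each leading `0` until the first `1`, then nothing. [folklore] -/
def zerosPrefixStep : ZPS → Bool → ZPS × List Bool
  | .run, false => (.run, [true])
  | .run, true => (.done, [])
  | .done, _ => (.done, [])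

/-- The transducer. [folklore] -/
def zerosPrefixT : FST ZPS Bool Bool where
  init := .run
  step := zerosPrefixStep
  front := fun _ => []
  keep := fun _ => true

/-- The transition of `zerosPrefixT` (definitional). [folklore] -/
@[simp] theorem zerosPrefixT_step (s : ZPS) (b : Bool) : zerosPrefixT.step s b = zerosPrefixStep s b := rfl

/-- Past the block nothing is emitted. [folklore] -/
theorem zerosPrefixT_run_done (w : List Bool) : (zerosPrefixT.run .done w).2 = [] := by
  induction w with
  | nil => rfl
  | cons b w ih => cases b <;> simpa [FST.run_cons, zerosPrefixStep] using ih

/-- Inside the block one `1` is emitted per leading `0`. [folklore] -/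
theorem zerosPrefixT_run_run (w : List Bool) : (zerosPrefixT.run .run w).2 = ones (leadingZeros w) := by
  induction w with
  | nil => rfl
  | cons b w ih =>
    cases b
    · simpa [FST.run_cons, zerosPrefixStep, leadingZeros, ones, List.replicate_succ] using ih
    · simpa [FST.run_cons, zerosPrefixStep, leadingZeros, ones] using zerosPrefixT_run_done w

/-- **The transducer computes `zerosPrefixFn`.** [folklore] -/
theorem zerosPrefixT_eval (w : List Bool) : zerosPrefixT.eval w = zerosPrefixFn w := by
  have h : zerosPrefixT.eval w = (zerosPrefixT.run .run w).2 := by simp [FST.eval, zerosPrefixT]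
  rw [h, zerosPrefixT_run_run, zerosPrefixFn]

/-- **`zerosPrefixFn ∈ FP`** (a finite-state transduction). [cite: AroraBarak2009, §1.3 (finite-state string processing is polynomial time)] -/
theorem zerosPrefixFn_mem_FP : zerosPrefixFn ∈ FP := by
  obtain ⟨p, M, hM⟩ := zerosPrefixT.polyTimeComputable_eval
  refine ⟨p, M, fun w => ?_⟩
  have h := hM w
  rw [show (id (zerosPrefixT.eval w) : List Bool) = zerosPrefixFn w from zerosPrefixT_eval w] at h
  exact h

end Literature.Computability.Complexity
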